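/-
Copyright (c) 2026 the pub-hodgecm-mathlib formalisation cell (harness21).  Prover seat hodgecm-mathlib-K2E3-p21 (g4), Track B «K2-LIT» ∕ h413
(`stmt-HodgeConjecture-24833`), line `K2_E3_EllipticInputs`, unit U12 §L, Richardson road for (LBGL-ge3) at `N = 3`, (F-E) ROAD v2 brick A′2 under the road owner's
name (K2E3-p11 (g5), 06:00:55Z «A′2 = YES» + «the COROLLARY H″ consumes»): «THE `𝔭`-SLICE TWIST FORM AND THE `Ad(GL₃(F))`-INVARIANCE OF `(k, r) ↦ Ad(k) P(r)`».  2026-09-04.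
-/
import Summits.HodgeConjecture.HodgeConjecture.Theorems.K2E3GL3ParabolicSliceFubini          -- ★ p857721 (this seat): `lintegral_pi_parabolic_conj_eq`, `lintegral_lintegral_pi_parabolic_conj_eq` (the `𝔭`-slice formula)
import Summits.HodgeConjecture.HodgeConjecture.Theorems.K2E3GL3ParabolicSliceAdInvariant    -- ★ p857693∕p857699 (this seat): `GL3.lintegral_pi_normAbs_mul_lintegral_prod_conj_leviBlock_eq` (D′)
import HarnessLib

/-!
# K2_E3 road (h413), §L — Richardson road for (LBGL-ge3) at `N = 3`, (F-E) ROAD v2: the `𝔭`-slice twist form under the road owner's name and its corollary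
# `∫_K ∫_𝔭 h(g · Ad(k)P · g⁻¹) dP dκ = ∫_K ∫_𝔭 h(Ad(k)P) dP dκ` — the push-forward of `κ ⊗ dP` under `(k, P) ↦ Ad(k) P` is `Ad(GL₃(F))`-invariant

Cell `pub/hodgecm-mathlib` (D-0151), Track B, seat K2E3-p21 (g4); road owner K2E3-p11 (g5) (06:00:55Z: «(1) → K2E3-p21 (g4): A′2 = YES — brick A′2
`Theorems/K2E3GL3ParabolicSliceTwistForm.lean` … HEAD `exists_lintegral_glInt_pi_conj_parabolic_eq (κ) [IsHaarMeasure κ] (μU) [IsHaarMeasure μU] (dx) …` + the COROLLARY H″ consumes: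
`lintegral_glInt_pi_conj_parabolic_conj_eq (g) (h) (hh)`»), §L lead K2E3-p12 (g5), dealer K2E3-plan (g3).  `--supports stmt-HodgeConjecture-24833 --as helper`; THEOREMS ONLY (no
definition ∕ instance ∕ notation ∕ named fact ∕ `sorry`); never imports `Cruxes/…/Lines`.  COUNT-NEUTRAL ((LBGL-ge3) stays OPEN).

THE MATHEMATICS.  `K = GL₃(𝒪)` with Haar `κ`, `𝔭 = 𝔭_{(2,1)} ≅ F⁷` (`P(r) = [[r₀,r₁,r₂],[r₃,r₄,r₅],[0,0,r₆]]`, `dP = dx^{⊗7}`), `U = U_{(2,1)}` with Haar `μ_U`, `𝔪 ≅ F⁵`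
(`M(m)`, `χ(m)` as in ★ A′∕D′).  (i) The head of ★ `K2E3GL3ParabolicSliceFubini.lintegral_lintegral_pi_parabolic_conj_eq` (stated there for any s-finite `κ`) under the road owner's
name and hypotheses (`κ` Haar ⇒ finite ⇒ s-finite): `∫_K∫_𝔭 h(Ad(k)P) = C ∫_𝔪 |χ(m)| ∫_{K×U} h(Ad(k u)M(m))`.  (ii) COROLLARY: replacing `h` by `h ∘ Ad(g)` and using the `Ad(GL₃(F))`-
invariance of the weighted Levi-slice functional (★ D′ `GL3.lintegral_pi_normAbs_mul_lintegral_prod_conj_leviBlock_eq`, with `μ_U := haar`):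
**`∫_K ∫_𝔭 h(g · Ad(k)P(r) · g⁻¹) dr dκ = ∫_K ∫_𝔭 h(Ad(k)P(r)) dr dκ`** for every `g ∈ GL₃(F)` and Borel `h ≥ 0` — the distribution `h ↦ ∫_K∫_𝔭 h(Ad(k)P)` is invariant.
[HarishChandra1999AdmissibleDistributions, §7 Lemma 7.8]; [HarishChandra1970, Part V §2 p. 49]; [Rogawski1990, §4.13 p. 70].

HONEST LABEL: HC_CM is proved only modulo the 7 printed citations (2 remaining named inputs: hLiu418 = stmt-HodgeConjecture-24832, h413 = stmt-HodgeConjecture-24833)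
until rung 0 closes; count-neutral helper.
-/

set_option autoImplicit false
set_option linter.dupNamespace false   -- `Summit.HodgeConjecture.HodgeConjecture.…` (D-0017 nested layout; lakefile exemption for Summits)

noncomputable section

open MeasureTheory MeasureTheory.Measure Filter Topology TopologicalSpace Polynomial Function
open scoped MatrixGroups NNReal ENNReal
open Literature.NumberTheory.Automorphic
open Literature.NumberTheory.GaloisRepresentations Literature.NumberTheory.GaloisRepresentations.IsNonarchimedeanLocalField
open Summit.HodgeConjecture.HodgeConjecture.Cruxes.H413.K2E3GLnRichardsonMeasureRadon
open Summit.HodgeConjecture.HodgeConjecture.Cruxes.H413.K2E3GL3ParabolicSliceFubini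
open Summit.HodgeConjecture.HodgeConjecture.Cruxes.H413.K2E3GL3ParabolicSliceAdInvariant

namespace Summit.HodgeConjecture.HodgeConjecture.Cruxes.H413.K2E3GL3ParabolicSliceTwistForm

variable {F : Type*} [Field F] [ValuativeRel F] [TopologicalSpace F] [IsNonarchimedeanLocalField F] [MeasurableSpace F] [BorelSpace F]
  [MeasurableSpace (GL (Fin 3) F)] [BorelSpace (GL (Fin 3) F)]
  [MeasurableSpace (Matrix (Fin 3) (Fin 3) F)] [BorelSpace (Matrix (Fin 3) (Fin 3) F)]

/-- **(F-E)-A′2 under the road owner's name: THE `𝔭`-SLICE TWIST FORM.**  `κ` Haar on `K = GL₃(𝒪)`, `μ_U` Haar on `U = U_{(2,1)}`, `dx` additive Haar on `F`.  There is ONE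
`C ∈ (0, ∞)` with, for every Borel `h : 𝔤𝔩₃(F) → [0, ∞]`:
**`∫⁻_K ∫⁻_{r ∈ F⁷} h(k P(r) k⁻¹) dr dκ = C ∫⁻_{m ∈ F⁵} |χ(m)|_F ∫⁻_{K×U} h((k u) M(m) (k u)⁻¹) d(κ⊗μ_U) dm`** (★ `K2E3GL3ParabolicSliceFubini.lintegral_lintegral_pi_parabolic_conj_eq`,
stated there for any s-finite `κ`). [cite: HarishChandra1999AdmissibleDistributions, §7 Lemma 7.8] [cite: Rogawski1990, §4.13 p. 70] -/
theorem exists_lintegral_glInt_pi_conj_parabolic_eq (κ : Measure ↥(glInt 3 F)) [IsHaarMeasure κ]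
    (μU : Measure ↥(unipotentRadicalGL F (![false, false, true] : Fin 3 → Bool))) [IsHaarMeasure μU] (dx : Measure F) [dx.IsAddHaarMeasure] :
    ∃ C : ℝ≥0∞, C ≠ 0 ∧ C ≠ ⊤ ∧ ∀ h : Matrix (Fin 3) (Fin 3) F → ℝ≥0∞, Measurable h →
      ∫⁻ k : ↥(glInt 3 F), ∫⁻ r : Fin 7 → F,
          h (((k : GL (Fin 3) F) : Matrix (Fin 3) (Fin 3) F) * !![r 0, r 1, r 2; r 3, r 4, r 5; 0, 0, r 6] * ((((k : GL (Fin 3) F))⁻¹ : GL (Fin 3) F) : Matrix (Fin 3) (Fin 3) F))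
          ∂(Measure.pi fun _ : Fin 7 => dx) ∂κ =
        C * ∫⁻ m : Fin 5 → F, (normAbs F ((!![m 0, m 1; m 2, m 3] : Matrix (Fin 2) (Fin 2) F).charpoly.eval (m 4)) : ℝ≥0∞) *
          ∫⁻ q : ↥(glInt 3 F) × ↥(unipotentRadicalGL F (![false, false, true] : Fin 3 → Bool)),
            h ((((q.1 : GL (Fin 3) F) * (q.2 : GL (Fin 3) F) : GL (Fin 3) F) : Matrix (Fin 3) (Fin 3) F) * !![m 0, m 1, 0; m 2, m 3, 0; 0, 0, m 4] *
              ((((q.1 : GL (Fin 3) F) * (q.2 : GL (Fin 3) F))⁻¹ : GL (Fin 3) F) : Matrix (Fin 3) (Fin 3) F)) ∂(κ.prod μU) ∂(Measure.pi fun _ : Fin 5 => dx) := by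
  haveI : T2Space F := (isLocalField F).toT2Space
  haveI : CompactSpace ↥(glInt 3 F) := isCompact_iff_compactSpace.1 (isCompact_glInt 3 F)
  haveI : IsFiniteMeasure κ := CompactSpace.isFiniteMeasure
  exact lintegral_lintegral_pi_parabolic_conj_eq κ μU dx

/-- **COROLLARY (consumed by H″): the push-forward of `κ ⊗ dr` under `(k, r) ↦ Ad(k) P(r)` is `Ad(GL₃(F))`-invariant.**  For `κ` Haar on `K = GL₃(𝒪)`, `dx` additive Haar on
`F`, every `g ∈ GL₃(F)` and every Borel `h : 𝔤𝔩₃(F) → [0, ∞]`: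
**`∫⁻_K ∫⁻_{r ∈ F⁷} h(g (k P(r) k⁻¹) g⁻¹) dr dκ = ∫⁻_K ∫⁻_{r ∈ F⁷} h(k P(r) k⁻¹) dr dκ`** (the twist form for `h ∘ Ad(g)` and for `h`, with `μ_U := haar`, and the
`Ad(GL₃(F))`-invariance of the weighted Levi-slice functional ★ `GL3.lintegral_pi_normAbs_mul_lintegral_prod_conj_leviBlock_eq`).
[cite: HarishChandra1999AdmissibleDistributions, §7 Lemma 7.8] [cite: HarishChandra1970, Part V §2 p. 49] [cite: Rogawski1990, §4.13 p. 70] -/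
theorem lintegral_glInt_pi_conj_parabolic_conj_eq (κ : Measure ↥(glInt 3 F)) [IsHaarMeasure κ] (dx : Measure F) [dx.IsAddHaarMeasure]
    (g : GL (Fin 3) F) (h : Matrix (Fin 3) (Fin 3) F → ℝ≥0∞) (hh : Measurable h) :
    ∫⁻ k : ↥(glInt 3 F), ∫⁻ r : Fin 7 → F,
        h ((g : Matrix (Fin 3) (Fin 3) F) *
            (((k : GL (Fin 3) F) : Matrix (Fin 3) (Fin 3) F) * !![r 0, r 1, r 2; r 3, r 4, r 5; 0, 0, r 6] * ((((k : GL (Fin 3) F))⁻¹ : GL (Fin 3) F) : Matrix (Fin 3) (Fin 3) F)) *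
          ((g⁻¹ : GL (Fin 3) F) : Matrix (Fin 3) (Fin 3) F)) ∂(Measure.pi fun _ : Fin 7 => dx) ∂κ =
      ∫⁻ k : ↥(glInt 3 F), ∫⁻ r : Fin 7 → F,
        h (((k : GL (Fin 3) F) : Matrix (Fin 3) (Fin 3) F) * !![r 0, r 1, r 2; r 3, r 4, r 5; 0, 0, r 6] * ((((k : GL (Fin 3) F))⁻¹ : GL (Fin 3) F) : Matrix (Fin 3) (Fin 3) F))
        ∂(Measure.pi fun _ : Fin 7 => dx) ∂κ := by
  classical
  haveI : T2Space F := (isLocalField F).toT2Space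
  haveI : LocallyCompactSpace F := (isLocalField F).toLocallyCompactSpace
  haveI : SecondCountableTopology F := secondCountableTopology_localField F
  haveI : IsTopologicalRing F := inferInstance
  -- a Haar measure on `U`
  haveI : BorelSpace ↥(unipotentRadicalGL F (![false, false, true] : Fin 3 → Bool)) := Subtype.borelSpace _
  obtain ⟨Φ, -, -⟩ := exists_boxHomeomorph_unipotentRadicalGL (R := F) (![false, false, true] : Fin 3 → Bool)
  haveI : LocallyCompactSpace ↥(unipotentRadicalGL F (![false, false, true] : Fin 3 → Bool)) := Φ.symm.isClosedEmbedding.locallyCompactSpace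
  haveI : IsTopologicalGroup ↥(unipotentRadicalGL F (![false, false, true] : Fin 3 → Bool)) := inferInstance
  set μU : Measure ↥(unipotentRadicalGL F (![false, false, true] : Fin 3 → Bool)) := haar with hμU
  obtain ⟨C, -, -, hA⟩ := exists_lintegral_glInt_pi_conj_parabolic_eq κ μU dx
  -- the twist form for `h ∘ Ad(g)` (Borel) and for `h`
  have hhg : Measurable fun X : Matrix (Fin 3) (Fin 3) F => h ((g : Matrix (Fin 3) (Fin 3) F) * X * ((g⁻¹ : GL (Fin 3) F) : Matrix (Fin 3) (Fin 3) F)) :=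
    hh.comp ((continuous_const.mul continuous_id).mul continuous_const).measurable
  have h1 := hA _ hhg
  have h2 := hA h hh
  -- `g (q M q⁻¹) g⁻¹ = (g q) M (g q)⁻¹`
  have hassoc : ∀ (q : ↥(glInt 3 F) × ↥(unipotentRadicalGL F (![false, false, true] : Fin 3 → Bool))) (m : Fin 5 → F),
      (g : Matrix (Fin 3) (Fin 3) F) *
          ((((q.1 : GL (Fin 3) F) * (q.2 : GL (Fin 3) F) : GL (Fin 3) F) : Matrix (Fin 3) (Fin 3) F) * !![m 0, m 1, 0; m 2, m 3, 0; 0, 0, m 4] *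
            ((((q.1 : GL (Fin 3) F) * (q.2 : GL (Fin 3) F))⁻¹ : GL (Fin 3) F) : Matrix (Fin 3) (Fin 3) F)) * ((g⁻¹ : GL (Fin 3) F) : Matrix (Fin 3) (Fin 3) F) =
        ((g * ((q.1 : GL (Fin 3) F) * (q.2 : GL (Fin 3) F)) : GL (Fin 3) F) : Matrix (Fin 3) (Fin 3) F) * !![m 0, m 1, 0; m 2, m 3, 0; 0, 0, m 4] *
          (((g * ((q.1 : GL (Fin 3) F) * (q.2 : GL (Fin 3) F)))⁻¹ : GL (Fin 3) F) : Matrix (Fin 3) (Fin 3) F) := fun q m => by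
    simp only [mul_inv_rev, Units.val_mul, Matrix.mul_assoc]
  simp_rw [hassoc] at h1
  rw [h1, h2, GL3.lintegral_pi_normAbs_mul_lintegral_prod_conj_leviBlock_eq κ μU dx g hh]

end Summit.HodgeConjecture.HodgeConjecture.Cruxes.H413.K2E3GL3ParabolicSliceTwistForm

end
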